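import Literature.Analysis.ODE.QuasiMonotoneBarrier
import HarnessLib

/-!
# Outward growth persists along a forbidden region (Riccati comparison, degenerate floor)

Topic `Literature/Analysis/ODE` (namespace `Literature.Analysis.ODE`). Complement to
`QuasiMonotoneBarrier.lean`: for a complex solution `u` of `y″ = q y` on `[t₀, T]` that never vanishes
there, with `q ≥ 0` (no positive floor required), once the logarithmic rate is non-negative,
`Re(ū u′)(t₀) ≥ 0`, it stays non-negative on `[t₀, T]`:

* `re_conj_mul_deriv_nonneg_persist` — `ζ = −Re(ū u′)/|u|²` obeys `ζ′ ≤ ζ² − q ≤ ζ²`; compare with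
  the super-solutions `δ/(1 − 2δ(x − t₀))` of `z′ = 2z²` for every small `δ > 0` and let `δ → 0`.

(`QuasiMonotoneBarrier.negRate_nonpos_of_subsolution` proves the same under a floor `q ≥ k² > 0`; the
present form is what continues the growth of the horizon-normalised solution of Carter's equation
through the last Airy layer of the barrier, where the coefficient degenerates at the turning point —
near-extremal Kerr programme, crux `KappaExplicitWaveDecay`.) All proved.

## References
* P. Hartman, *Ordinary Differential Equations* (SIAM Classics 38, 2002), Ch. XI §§2, 6. Key
  `Hartman2002`.
-/

noncomputable section

open Set Filter Topology
open scoped ComplexConjugate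

namespace Literature.Analysis.ODE

section Persist

variable {u u' : ℝ → ℂ} {q : ℝ → ℝ} {t₀ T : ℝ}

/-- **Outward growth persists where `q ≥ 0`.** Let `u` solve `y″ = q y` on `[t₀, T]` (pointwise
`HasDerivAt` data) with `u ≠ 0` and `q ≥ 0` there, and `Re(ū u′)(t₀) ≥ 0`. Then
`Re(ū u′)(x) ≥ 0` for every `x ∈ [t₀, T]`. [cite: Hartman2002, Ch. XI §6] -/
theorem re_conj_mul_deriv_nonneg_persist
    (hu : ∀ x ∈ Icc t₀ T, HasDerivAt u (u' x) x ∧ HasDerivAt u' ((q x : ℂ) * u x) x)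
    (hne : ∀ x ∈ Icc t₀ T, u x ≠ 0) (hq : ∀ x ∈ Icc t₀ T, 0 ≤ q x)
    (h0 : 0 ≤ (conj (u t₀) * u' t₀).re) :
    ∀ x ∈ Icc t₀ T, 0 ≤ (conj (u x) * u' x).re := by
  intro x hx
  have hxT : t₀ ≤ T := hx.1.trans hx.2
  set ζ : ℝ → ℝ := fun y ↦ -(conj (u y) * u' y).re / ‖u y‖ ^ 2 with hζ
  have hder : ∀ y ∈ Icc t₀ T, HasDerivAt ζ (ζ y ^ 2 - q y -
      (‖u' y‖ ^ 2 / ‖u y‖ ^ 2 - ζ y ^ 2)) y ∧ 0 ≤ ‖u' y‖ ^ 2 / ‖u y‖ ^ 2 - ζ y ^ 2 :=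
    fun y hy ↦ hasDerivAt_negRate hu hy (hne y hy)
  have hζ0 : ζ t₀ ≤ 0 := by
    have hpos : 0 < ‖u t₀‖ ^ 2 := by have := hne t₀ (left_mem_Icc.2 hxT); positivity
    show -(conj (u t₀) * u' t₀).re / ‖u t₀‖ ^ 2 ≤ 0
    exact div_nonpos_of_nonpos_of_nonneg (by linarith) hpos.le
  -- for every small `δ > 0`, `ζ ≤ 2δ` on `[t₀, T]`
  have hsmall : ∀ δ : ℝ, 0 < δ → 4 * δ * (T - t₀) ≤ 1 → ζ x ≤ 2 * δ := by
    intro δ hδ hlen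
    set B : ℝ → ℝ := fun y ↦ δ / (1 - 2 * δ * (y - t₀)) with hB
    have hden : ∀ y ∈ Icc t₀ T, 1 / 2 ≤ 1 - 2 * δ * (y - t₀) := by
      intro y hy
      have : 2 * δ * (y - t₀) ≤ 2 * δ * (T - t₀) :=
        mul_le_mul_of_nonneg_left (by linarith [hy.2]) (by positivity)
      linarith
    have hBder : ∀ y ∈ Icc t₀ T, HasDerivAt B (2 * B y ^ 2) y := by
      intro y hy
      have hd0 : 1 - 2 * δ * (y - t₀) ≠ 0 := by linarith [hden y hy]
      have h1 : HasDerivAt (fun z ↦ 1 - 2 * δ * (z - t₀)) (-(2 * δ)) y := by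
        have := (((hasDerivAt_id y).sub_const t₀).const_mul (2 * δ)).const_sub 1
        simpa using this
      have h2 := (hasDerivAt_const y δ).div h1 hd0
      refine h2.congr_deriv ?_
      simp only [hB]
      field_simp
      ring
    have key := image_le_of_deriv_right_lt_deriv_boundary' (f := ζ) (a := t₀) (b := T)
      (f' := fun y ↦ ζ y ^ 2 - q y - (‖u' y‖ ^ 2 / ‖u y‖ ^ 2 - ζ y ^ 2))
      (fun y hy ↦ (hder y hy).1.continuousAt.continuousWithinAt)
      (fun y hy ↦ (hder y (Ico_subset_Icc_self hy)).1.hasDerivWithinAt)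
      (B := B) (B' := fun y ↦ 2 * B y ^ 2)
      (by simp only [hB]; rw [sub_self, mul_zero, sub_zero, div_one]; exact hζ0.trans hδ.le)
      (fun y hy ↦ (hBder y hy).continuousAt.continuousWithinAt)
      (fun y hy ↦ (hBder y (Ico_subset_Icc_self hy)).hasDerivWithinAt)
      (fun y hy hyB ↦ by
        have hy' : y ∈ Icc t₀ T := Ico_subset_Icc_self hy
        have hD := (hder y hy').2
        have hBpos : 0 < B y := div_pos hδ (by linarith [hden y hy'])
        have hq0 := hq y hy'
        show ζ y ^ 2 - q y - (‖u' y‖ ^ 2 / ‖u y‖ ^ 2 - ζ y ^ 2) < 2 * B y ^ 2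
        rw [hyB]; nlinarith)
    have h1 : ζ x ≤ B x := key hx
    have h2 : B x ≤ 2 * δ := by
      simp only [hB]
      rw [div_le_iff₀ (by linarith [hden x hx])]
      nlinarith [hden x hx]
    exact h1.trans h2
  -- let `δ → 0`
  have hζx : ζ x ≤ 0 := by
    by_contra hcon
    push Not at hcon
    -- choose `δ` with `2δ < ζ x` and `4δ(T − t₀) ≤ 1`
    obtain ⟨δ, hδ0, hδ1, hδ2⟩ : ∃ δ : ℝ, 0 < δ ∧ 2 * δ < ζ x ∧ 4 * δ * (T - t₀) ≤ 1 := by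
      refine ⟨min (ζ x / 4) (1 / (4 * (T - t₀) + 4)), ?_, ?_, ?_⟩
      · refine lt_min (by linarith) (by have : 0 ≤ T - t₀ := sub_nonneg.2 hxT; positivity)
      · have := min_le_left (ζ x / 4) (1 / (4 * (T - t₀) + 4)); linarith
      · have hm := min_le_right (ζ x / 4) (1 / (4 * (T - t₀) + 4))
        have hT0 : 0 ≤ T - t₀ := sub_nonneg.2 hxT
        have hpos : 0 < 4 * (T - t₀) + 4 := by positivity
        calc 4 * min (ζ x / 4) (1 / (4 * (T - t₀) + 4)) * (T - t₀)
            ≤ 4 * (1 / (4 * (T - t₀) + 4)) * (T - t₀) := by gcongr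
          _ = 4 * (T - t₀) / (4 * (T - t₀) + 4) := by ring
          _ ≤ 1 := by rw [div_le_one hpos]; linarith
    have := hsmall δ hδ0 hδ2
    linarith
  have hpos : 0 < ‖u x‖ ^ 2 := by have := hne x hx; positivity
  have h2 := (div_le_iff₀ hpos).1 (show -(conj (u x) * u' x).re / ‖u x‖ ^ 2 ≤ 0 from hζx)
  linarith

end Persist

end Literature.Analysis.ODE

end
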